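import Summits.HodgeConjecture.HodgeConjecture.Theorems.Ring2AbelianAllWeilFieldCM
import HarnessLib

/-!
# Ring 2 · AbelianAll (ab-weil-1, gen 10, part 8b) — the definite splitting of `τ(Ψ)` at every complex
  embedding `τ` of `K_d` (van Geemen, Lemma 5.2 (4), in Landherr's format)

research route, not a corollary; conditional on HC_CM plus one named minimal statement.
Cell line: research route conditional on HC_CM; not a corollary; Q11.4-sentence-2 already refuted in dim ≥ 3.
`HC_CM` (`Theses.RankFourFaces.CMAbelianHodge`) does not occur in this file and no open case of the Hodge
conjecture is claimed.  Input: the Hodge–Riemann bilinear relation in degree one (the tree's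
`exists_pos_polarizationPairingOne_weilOperatorOne`, Voisin I Thm. 6.32).

## What is proved (0 sorry)

For `(A, φ)` with `dim A = 2n`, `φ² = -d` (`d ≥ 1`) and BOTH eigenvalues `± i√d` of `φ^*` of multiplicity
`n` on `H^{1,0}(A)` (Weil type `(n, n)`), `h_K = d·e^*a + φ^*e^*a` (`a ≠ 0` rational) and a Gram witness
`(x, ω, a, b)` of the carrier (`x ∪ φ^*x` a basis of rational classes of `H¹(A, ℂ)`,
`Q_{h_K}(x_i, φ^*x_j) = a_ij ω`, `Q_{h_K}(x_i, x_j) = b_ij ω`), and ANY embedding `τ : K_d →+* ℂ`: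
`ℂ^{2n} = P ⊕ N` with `dim P = dim N = n`, `τ(Ψ)` positive definite on `P` and negative definite on `N`
(`exists_definite_splitting_map_weilGram`).  The computation (`definite_splitting_aux`, at `τ(√-d) = iy`,
`y = ±√d`): with `u_j = φ^*x_j + iy·x_j` (a basis of the `iy`-eigenspace `V` of `φ^*`, `dim V = 2n`) and
`G_ij = i·B(ū_i, u_j)` (`B = Q_{h_K}/ω`), `τ(Ψ) = (2y)⁻¹ · G`; Hodge–Riemann makes `i B(v̄, v)` definite of
opposite signs on `V ∩ H^{1,0}` and `V ∩ H^{0,1}` (dimensions `n`, `n`).  This generalises part 3's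
sign computation (`Ring2AbelianAllWeilSignature`, one embedding, determinant only) to both embeddings and
to the full inertia; it is consumed by `Ring2AbelianAllWeilLandherrUniqueness`.

What is NOT proved or claimed: any statement about moduli, the variational Hodge conjecture or
algebraicity of Weil classes; no Literature fact is introduced; no internally-minted statement is cited
as a fact.

## References

* [vanGeemen1994HodgeAV] B. van Geemen, An introduction to the Hodge conjecture for abelian varieties,
  LNM 1594 (1994), 4.9, Lemma 5.2 (4), 5.3.
* [VoisinHodgeI2002] C. Voisin, Hodge Theory and Complex Algebraic Geometry I, Thm. 6.32.
-/

noncomputable section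

set_option linter.dupNamespace false

open CategoryTheory Polynomial NumberField
open Literature.AlgebraicGeometry Literature.AlgebraicGeometry.Motives
open Literature.AlgebraicGeometry.HodgeTheory
open Literature.AlgebraicGeometry.VanGeemen1994
open Literature.AlgebraicTopology.SingularHomology
open Literature.NumberTheory.QuadraticForms

namespace Summit.HodgeConjecture.HodgeConjecture.Ring2.AbelianAll

/-! ### §2 The definite complex model of `τ(Ψ)` at an embedding `τ` -/

section Model

open Matrix

/-- The computation at ONE embedding `τ : K_d → ℂ`, `τ(√-d) = ε = iy` (`y = ±√d`): with `u_j = φ^*x_j + ε x_j`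
(a basis of the `ε`-eigenspace `V_ε` of `φ^*`, `dim V_ε = 2n`) and `G_ij = i·B(ū_i, u_j)` (`B = Q/ω`),
`τ(Ψ) = (2ε)⁻¹ i · G`; Hodge–Riemann makes `i B(v̄, v)` definite of opposite signs on `V_ε ∩ H^{1,0}` and
`V_ε ∩ H^{0,1}` (dimensions `n`, `n` by the multiplicity hypothesis), so `τ(Ψ)` is definite of opposite
signs on the two halves of a splitting `ℂ^{2n} = P ⊕ N`, `dim P = dim N = n`. [cite: vanGeemen1994HodgeAV, Lemma 5.2 (4)] -/
theorem definite_splitting_aux {A : AbelianVariety ℂ} {φ : A ⟶ A} {n d m : ℕ}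
    (hd : 0 < d) (hA : A.dim = 2 * n) (hφ : φ ≫ φ = -(d • 𝟙 A)) (hmn : 2 * n = m + 1)
    {y : ℝ} (hy2 : (Complex.I * (y : ℂ)) * (Complex.I * (y : ℂ)) = -(d : ℂ))
    (hV : Module.finrank ℂ ↥(Module.End.eigenspace (complexBetti.map φ.hom.hom.hom 1).hom (Complex.I * (y : ℂ))) =
      2 * n)
    (hP10 : Module.finrank ℂ ↥(Module.End.eigenspace (complexBetti.map φ.hom.hom.hom 1).hom (Complex.I * (y : ℂ)) ⊓
      hodgeOneZero (Motives.isSmoothProjective_of_dim_eq' hA)) = n)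
    (e : ProjectiveEmbedding A.X) {a : complexBetti (projectiveSpace e.n ℂ) 2} (haQ : IsRationalClass a) (ha0 : a ≠ 0)
    (x : Fin (2 * n) → complexBetti A.X 1) (ω : complexBetti A.X (2 + 2 * m))
    (am bm : Matrix (Fin (2 * n)) (Fin (2 * n)) ℚ) (hx : ∀ i, IsRationalClass (x i))
    (hind : LinearIndependent ℂ (Sum.elim x (fun i => complexBetti.map φ.hom.hom.hom 1 (x i))))
    (hω : IsRationalClass ω) (hω0 : ω ≠ 0)
    (hQ : ∀ i j, polarizationPairingOne A.X
          ((d : ℂ) • complexBetti.map e.ι 2 a + complexBetti.map φ.hom.hom.hom 2 (complexBetti.map e.ι 2 a)) m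
          (x i) (complexBetti.map φ.hom.hom.hom 1 (x j)) = ((am i j : ℚ) : ℂ) • ω ∧
        polarizationPairingOne A.X
          ((d : ℂ) • complexBetti.map e.ι 2 a + complexBetti.map φ.hom.hom.hom 2 (complexBetti.map e.ι 2 a)) m
          (x i) (x j) = ((bm i j : ℚ) : ℂ) • ω)
    (τ : weilField d →+* ℂ) (hτ : τ (weilSqrt d) = Complex.I * (y : ℂ)) :
    ∃ P N : Submodule ℂ (Fin (2 * n) → ℂ), IsCompl P N ∧ Module.finrank ℂ P = n ∧ Module.finrank ℂ N = n ∧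
      (∀ p ∈ P, p ≠ 0 → 0 < (star p ⬝ᵥ (weilGramMatrix d am bm).map τ *ᵥ p).re) ∧
      (∀ p ∈ N, p ≠ 0 → (star p ⬝ᵥ (weilGramMatrix d am bm).map τ *ᵥ p).re < 0) := by
  classical
  haveI := finite_complexBetti_abelianVariety A 1
  have hm1 : 1 ≤ m := by omega
  have hA' : A.dim = m + 1 := hA.trans hmn
  have hX' : IsSmoothProjective (m + 1) A.X := Motives.isSmoothProjective_of_dim_eq' hA'
  have hd0 : (d : ℂ) ≠ 0 := Nat.cast_ne_zero.2 hd.ne'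
  have hτq : ∀ r : ℚ, τ (algebraMap ℚ (weilField d) r) = (r : ℂ) := embedding_algebraMap τ
  -- notation: `Y = A(ℂ)`, `h_K`, `Q = Q_{h_K}`, `T = φ^*`, `ε = iy`
  set Y := ComplexPoints A.X with hYdef
  set hK := (d : ℂ) • complexBetti.map e.ι 2 a + complexBetti.map φ.hom.hom.hom 2 (complexBetti.map e.ι 2 a)
    with hKdef
  set Q := polarizationPairingOne A.X hK m with hQdef
  set T := (complexBetti.map φ.hom.hom.hom 1).hom with hTdef
  set ε : ℂ := Complex.I * (y : ℂ) with hεdef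
  have hε2 : ε * ε = -(d : ℂ) := hy2
  have hεconj : starRingEnd ℂ ε = -ε := by
    rw [hεdef, map_mul, Complex.conj_I, Complex.conj_ofReal, neg_mul]
  have hε0 : ε ≠ 0 := by
    intro h
    rw [h, mul_zero] at hε2
    exact hd0 (neg_eq_zero.1 hε2.symm)
  have hy0 : y ≠ 0 := by
    intro h
    apply hε0
    rw [hεdef, h, Complex.ofReal_zero, mul_zero]
  have hT2 : ∀ v, T (T v) = -((d : ℂ) • v) := fun v => complexBetti_map_map_one_of_comp_self hφ v
  have hTconj : ∀ v, conjClass Y 1 (T v) = T (conjClass Y 1 v) := fun v => conjClass_map _ v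
  have hQTT : ∀ v w, Q (T v) (T w) = (d : ℂ) • Q v w :=
    fun v w => polarizationPairingOne_map_map_ksymm hA' hd hφ e a v w
  have hQswap : ∀ v w, Q w v = -Q v w := fun v w => polarizationPairingOne_swap hK m v w
  have hQself : ∀ v, Q v v = 0 := fun v => polarizationPairingOne_self hK m v
  have hQconj : ∀ v w, conjClass Y (2 + 2 * m) (Q v w) = Q (conjClass Y 1 v) (conjClass Y 1 w) :=
    fun v w => conjClass_polarizationPairingOne (isRationalClass_ksymm d φ e haQ) m v w
  have hKtype : IsOfHodgeType (m + 1) A.X 2 1 1 hK := isOfHodgeType_one_one_ksymm hA' hd φ e haQ ha0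
  have hQ01 : ∀ w ∈ hodgeZeroOne hX', ∀ w' ∈ hodgeZeroOne hX', Q w w' = 0 :=
    fun w hw w' hw' => polarizationPairingOne_eq_zero_of_mem_hodgeZeroOne hX' hKtype hw hw'
  -- the coordinate `ℓ` on the line `H^{2m+2}` (`c = ℓ c • ω`) and the scalar form `B = ℓ ∘ Q`
  have hline : ∀ c : complexBetti A.X (2 + 2 * m), ∃ r : ℂ, r • ω = c :=
    (finrank_eq_one_iff_of_nonzero' ω hω0).1 (Motives.finrank_complexBetti_two_add_two_mul_eq_one hX')
  obtain ⟨ℓ₀, hℓ₀⟩ := Module.Projective.exists_dual_ne_zero ℂ hω0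
  set ℓ : complexBetti A.X (2 + 2 * m) →ₗ[ℂ] ℂ := (ℓ₀ ω)⁻¹ • (ℓ₀ : complexBetti A.X (2 + 2 * m) →ₗ[ℂ] ℂ)
    with hℓdef
  have hℓω : ℓ ω = 1 := by rw [hℓdef, LinearMap.smul_apply, smul_eq_mul, inv_mul_cancel₀ hℓ₀]
  have hcoord : ∀ c, c = ℓ c • ω := by
    intro c
    obtain ⟨r, rfl⟩ := hline c
    rw [map_smul, smul_eq_mul, hℓω, mul_one]
  set B : complexBetti A.X 1 →ₗ[ℂ] complexBetti A.X 1 →ₗ[ℂ] ℂ := Q.compr₂ ℓ with hBdef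
  have hB : ∀ v w, B v w = ℓ (Q v w) := fun v w => rfl
  have hBQ : ∀ v w, Q v w = B v w • ω := fun v w => hcoord _
  have hBa : ∀ i j, B (x i) (T (x j)) = ((am i j : ℚ) : ℂ) := by
    intro i j; rw [hB, (hQ i j).1, map_smul, hℓω, smul_eq_mul, mul_one]
  have hBb : ∀ i j, B (x i) (x j) = ((bm i j : ℚ) : ℂ) := by
    intro i j; rw [hB, (hQ i j).2, map_smul, hℓω, smul_eq_mul, mul_one]
  have hBTT : ∀ v w, B (T v) (T w) = (d : ℂ) * B v w := by
    intro v w; rw [hB, hQTT, map_smul, smul_eq_mul, hB]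
  have hBswap : ∀ v w, B w v = -B v w := by intro v w; rw [hB, hQswap, map_neg, hB]
  have hBself : ∀ v, B v v = 0 := by intro v; rw [hB, hQself, map_zero]
  have hBconj : ∀ v w, starRingEnd ℂ (B v w) = B (conjClass Y 1 v) (conjClass Y 1 w) := by
    intro v w
    have h := hQconj v w
    rw [hBQ v w, conjClass_smul, hω.conjClass_eq, hBQ (conjClass Y 1 v)] at h
    exact smul_left_injective ℂ hω0 h
  have hB01 : ∀ w ∈ hodgeZeroOne hX', ∀ w' ∈ hodgeZeroOne hX', B w w' = 0 := by
    intro w hw w' hw'; rw [hB, hQ01 w hw w' hw', map_zero]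
  -- `V_ε` is `B`-isotropic (`K`-compatibility: `B(Tv, Tw) = d B(v, w)` against `ε² = -d`)
  have hBiso : ∀ v w, T v = ε • v → T w = ε • w → B v w = 0 := by
    intro v w hv hw
    have h := hBTT v w
    rw [hv, hw] at h
    simp only [map_smul, LinearMap.smul_apply, smul_eq_mul] at h
    have h2 : (2 * (d : ℂ)) * B v w = 0 := by linear_combination -h + (B v w) * hε2
    exact (mul_eq_zero.1 h2).resolve_left (mul_ne_zero two_ne_zero hd0)
  -- Hodge–Riemann for `h_K`, read through `ℓ`: the rational scale `r₀ = ℓ ω₀ ∈ ℝ^×`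
  obtain ⟨ω₀, hω₀Q, hω₀0, hpos⟩ := exists_pos_polarizationPairingOne_weilOperatorOne hm1 hA' hd φ e haQ ha0
  set r₀ : ℂ := ℓ ω₀ with hr₀def
  have hω₀ : ω₀ = r₀ • ω := hcoord ω₀
  have hr₀im : r₀.im = 0 := im_eq_zero_of_smul_eq_of_conjClass_eq hω₀Q.conjClass_eq hω.conjClass_eq hω0 hω₀
  have hr₀0 : r₀ ≠ 0 := fun h => hω₀0 (by rw [hω₀, h, zero_smul])
  set ρ : ℝ := r₀.re with hρdef
  have hr₀real : (ρ : ℂ) = r₀ := Complex.ext (by rw [Complex.ofReal_re]) (by rw [Complex.ofReal_im, hr₀im])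
  have hρ0 : ρ ≠ 0 := fun h => hr₀0 (by rw [← hr₀real, h, Complex.ofReal_zero])
  -- Hodge–Riemann: `B(z, z̄) = t r₀ · (i/2)` with `t > 0`, for `z ∈ H^{1,0} ∖ 0`
  have hHR : ∀ z ∈ hodgeOneZero hX', z ≠ 0 →
      ∃ t : ℝ, 0 < t ∧ B z (conjClass Y 1 z) = ((t : ℂ) * r₀) * (Complex.I / 2) := by
    intro z hz hz0
    have hzb : conjClass Y 1 z ∈ hodgeZeroOne hX' := conjClass_mem_hodgeZeroOne hX' hz
    have hxreal : conjClass Y 1 (z + conjClass Y 1 z) = z + conjClass Y 1 z := by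
      rw [conjClass_add, conjClass_conjClass, add_comm]
    have hx0 : z + conjClass Y 1 z ≠ 0 := by
      intro h0
      have hneg : conjClass Y 1 z = -z := eq_neg_of_add_eq_zero_right h0
      have h10 : conjClass Y 1 z ∈ hodgeOneZero hX' := by rw [hneg]; exact Submodule.neg_mem _ hz
      have hzero : conjClass Y 1 z = 0 := by
        have h' := Submodule.mem_inf.2 ⟨h10, hzb⟩
        rwa [hodgeOneZero_inf_hodgeZeroOne hX', Submodule.mem_bot] at h'
      apply hz0
      rw [← conjClass_conjClass (Y := Y) (k := 1) z, hzero, conjClass_zero]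
    obtain ⟨t, ht, hE⟩ := hpos _ hxreal hx0
    have hC : weilOperatorOne hX' (z + conjClass Y 1 z) = Complex.I • z + -(Complex.I • conjClass Y 1 z) := by
      rw [map_add, weilOperatorOne_of_mem_hodgeOneZero hX' hz, weilOperatorOne_of_mem_hodgeZeroOne hX' hzb]
    have hE' : B (z + conjClass Y 1 z) (Complex.I • z + -(Complex.I • conjClass Y 1 z)) = (t : ℂ) * r₀ := by
      rw [← hC, hB]
      have hE₁ : Q (z + conjClass Y 1 z) (weilOperatorOne hX' (z + conjClass Y 1 z)) = (t : ℂ) • ω₀ := hE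
      rw [hE₁, hω₀, smul_smul, map_smul, hℓω, smul_eq_mul, mul_one]
    have hcz : B (conjClass Y 1 z) z = -B z (conjClass Y 1 z) := hBswap _ _
    simp only [map_add, map_neg, map_smul, LinearMap.add_apply, smul_eq_mul, hBself, hcz] at hE'
    refine ⟨t, ht, ?_⟩
    linear_combination (Complex.I / 2) * hE' + (B z (conjClass Y 1 z)) * Complex.I_mul_I
  -- the basis `u_j = T x_j + ε x_j` of `V_ε`
  set u : Fin (2 * n) → complexBetti A.X 1 := fun j => T (x j) + ε • x j with hudef
  have hu_eig : ∀ j, T (u j) = ε • u j := fun j => by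
    simp only [hudef, map_add, map_smul, hT2, smul_add, smul_smul, hε2, neg_smul]; abel
  have hubar : ∀ j, conjClass Y 1 (u j) = T (x j) - ε • x j := fun j => by
    simp only [hudef]
    rw [conjClass_add, hTconj, (hx j).conjClass_eq, conjClass_smul, (hx j).conjClass_eq, hεconj, neg_smul,
      sub_eq_add_neg]
  have hxu : ∀ i, (2 * ε) • x i = u i - conjClass Y 1 (u i) := fun i => by
    rw [hubar]; simp only [hudef, mul_smul, two_smul]; abel
  have hBxu : ∀ i j, B (x i) (u j) = ((am i j : ℚ) : ℂ) + ((bm i j : ℚ) : ℂ) * ε := fun i j => by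
    simp only [hudef]; rw [map_add, map_smul, hBa, hBb, smul_eq_mul, mul_comm]
  have hli : LinearIndependent ℂ u := linearIndependent_map_add_smul T x ε hind
  set Φ : (Fin (2 * n) → ℂ) →ₗ[ℂ] complexBetti A.X 1 := Fintype.linearCombination ℂ u with hΦdef
  have hΦapply : ∀ c, Φ c = ∑ j, c j • u j := fun c => Fintype.linearCombination_apply ℂ u c
  have hinj : Function.Injective Φ := hli.fintypeLinearCombination_injective
  have hΦconj : ∀ c, conjClass Y 1 (Φ c) = ∑ j, starRingEnd ℂ (c j) • conjClass Y 1 (u j) := fun c => by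
    rw [hΦapply, conjClass_sum_smul]
  -- `range Φ = V_ε`, of dimension `2n`
  have hle : LinearMap.range Φ ≤ Module.End.eigenspace T ε := by
    rw [hΦdef, Fintype.range_linearCombination]
    refine Submodule.span_le.2 ?_
    rintro _ ⟨j, rfl⟩
    exact Module.End.mem_eigenspace_iff.2 (hu_eig j)
  have hrange : LinearMap.range Φ = Module.End.eigenspace T ε :=
    Submodule.eq_of_le_of_finrank_eq hle (by rw [LinearMap.finrank_range_of_inj hinj, Module.finrank_fin_fun, hV])
  have hΦeig : ∀ c, T (Φ c) = ε • Φ c := fun c =>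
    Module.End.mem_eigenspace_iff.1 (hrange ▸ LinearMap.mem_range_self Φ c)
  -- the splitting `ℂ^{2n} = Φ⁻¹ H^{1,0} ⊕ Φ⁻¹ H^{0,1}`
  set P : Submodule ℂ (Fin (2 * n) → ℂ) := (hodgeOneZero hX').comap Φ with hPdef
  set N : Submodule ℂ (Fin (2 * n) → ℂ) := (hodgeZeroOne hX').comap Φ with hNdef
  have hPN : IsCompl P N := by
    refine ⟨Submodule.disjoint_def.2 fun c hc1 hc2 => ?_, codisjoint_iff.2 (eq_top_iff.2 fun c _ => ?_)⟩
    · have h0 : Φ c = 0 := by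
        have h' := Submodule.mem_inf.2 ⟨Submodule.mem_comap.1 hc1, Submodule.mem_comap.1 hc2⟩
        rwa [hodgeOneZero_inf_hodgeZeroOne hX', Submodule.mem_bot] at h'
      exact hinj (by rw [h0, map_zero])
    · obtain ⟨α, β, hαβ, hα, hβ⟩ := exists_add_eq_of_isOfHodgeType_one hX' (Φ c)
      obtain ⟨hTα, hTβ⟩ := eigenvector_components hX' φ.hom.hom.hom ε (hΦeig c) hαβ hα hβ
      obtain ⟨cα, hcα⟩ := LinearMap.mem_range.1
        (show α ∈ LinearMap.range Φ by rw [hrange]; exact Module.End.mem_eigenspace_iff.2 hTα)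
      obtain ⟨cβ, hcβ⟩ := LinearMap.mem_range.1
        (show β ∈ LinearMap.range Φ by rw [hrange]; exact Module.End.mem_eigenspace_iff.2 hTβ)
      have hc : c = cα + cβ := hinj (by rw [map_add, hcα, hcβ, hαβ])
      rw [hc]
      exact Submodule.add_mem_sup (Submodule.mem_comap.2 (by rw [hcα]; exact hα))
        (Submodule.mem_comap.2 (by rw [hcβ]; exact hβ))
  -- dimension count: `dim P = dim (V_ε ∩ H^{1,0}) = n` (hypothesis), `dim N = 2n - n = n`
  have hH10 : hodgeOneZero (Motives.isSmoothProjective_of_dim_eq' hA) = hodgeOneZero hX' :=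
    hodgeOneZero_congr hmn _ _
  have hfinP : Module.finrank ℂ P = n := by
    rw [hPdef, (Submodule.equivMapOfInjective Φ hinj _).finrank_eq, Submodule.map_comap_eq, hrange, ← hH10]
    exact hP10
  have hfinN : Module.finrank ℂ N = n := by
    have h := Submodule.finrank_sup_add_finrank_inf_eq P N
    rw [hPN.sup_eq_top, hPN.inf_eq_bot, finrank_top, finrank_bot, Module.finrank_fin_fun, hfinP] at h
    omega
  -- the Gram matrix `G_ij = i B(ū_i, u_j)` of the Hermitian form `i B(v̄, w)` on `V_ε`
  set G : Matrix (Fin (2 * n)) (Fin (2 * n)) ℂ :=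
    Matrix.of fun i j => Complex.I * B (conjClass Y 1 (u i)) (u j) with hGdef
  have hform : ∀ c c' : Fin (2 * n) → ℂ, star c ⬝ᵥ G *ᵥ c' = Complex.I * B (conjClass Y 1 (Φ c)) (Φ c') := by
    intro c c'
    rw [hGdef, star_dotProduct_gram_mulVec, hΦconj, hΦapply]
  -- `τ(Ψ) = (2ε)⁻¹ i · G`, and `(2ε)⁻¹ i = (2y)⁻¹ ∈ ℝ`
  have hκ : (2 * ε)⁻¹ * Complex.I = (((2 * y)⁻¹ : ℝ) : ℂ) := by
    rw [hεdef]
    push_cast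
    rw [mul_inv, mul_inv, mul_inv, Complex.inv_I]
    linear_combination (-((2 : ℂ)⁻¹ * (y : ℂ)⁻¹)) * Complex.I_mul_I
  have hM : (weilGramMatrix d am bm).map τ = ((2 * ε)⁻¹ * Complex.I) • G := by
    ext i j
    rw [Matrix.map_apply, weilGramMatrix_apply, map_add, map_mul, hτq, hτq, hτ, Matrix.smul_apply, smul_eq_mul,
      hGdef, Matrix.of_apply]
    have h := congrArg (fun v => B v (u j)) (hxu i)
    simp only [map_smul, map_sub, LinearMap.smul_apply, LinearMap.sub_apply, smul_eq_mul,
      hBiso (u i) (u j) (hu_eig i) (hu_eig j), hBxu] at h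
    have hinv : 2 * ε * (2 * ε)⁻¹ = 1 := mul_inv_cancel₀ (mul_ne_zero two_ne_zero hε0)
    linear_combination (2 * ε)⁻¹ * h - ((((am i j : ℚ) : ℂ)) + ((bm i j : ℚ) : ℂ) * ε) * hinv -
      ((2 * ε)⁻¹ * B (conjClass Y 1 (u i)) (u j)) * Complex.I_mul_I
  have hformτ : ∀ p : Fin (2 * n) → ℂ, star p ⬝ᵥ (weilGramMatrix d am bm).map τ *ᵥ p =
      (((2 * y)⁻¹ : ℝ) : ℂ) * (Complex.I * B (conjClass Y 1 (Φ p)) (Φ p)) := by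
    intro p
    rw [hM, Matrix.smul_mulVec, dotProduct_smul, smul_eq_mul, hform, hκ]
  -- the values of the form on `P` and on `N`
  have hvalP : ∀ p ∈ P, p ≠ 0 → ∃ t : ℝ, 0 < t ∧
      (star p ⬝ᵥ (weilGramMatrix d am bm).map τ *ᵥ p).re = t / 4 * (ρ / y) := by
    intro p hp hp0
    have hz : Φ p ∈ hodgeOneZero hX' := Submodule.mem_comap.1 hp
    have hz0 : Φ p ≠ 0 := fun h => hp0 (hinj (by rw [h, map_zero]))
    obtain ⟨t, ht, hBz⟩ := hHR _ hz hz0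
    refine ⟨t, ht, ?_⟩
    have hval : star p ⬝ᵥ (weilGramMatrix d am bm).map τ *ᵥ p = ((t / 4 * (ρ / y) : ℝ) : ℂ) := by
      rw [hformτ, hBswap, hBz, ← hr₀real]
      push_cast
      linear_combination (-((2 * (y : ℂ))⁻¹ * (t : ℂ) * (ρ : ℂ) / 2)) * Complex.I_mul_I
    rw [hval, Complex.ofReal_re]
  have hvalN : ∀ p ∈ N, p ≠ 0 → ∃ t : ℝ, 0 < t ∧
      (star p ⬝ᵥ (weilGramMatrix d am bm).map τ *ᵥ p).re = -(t / 4 * (ρ / y)) := by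
    intro p hp hp0
    have hw : Φ p ∈ hodgeZeroOne hX' := Submodule.mem_comap.1 hp
    have hw0 : Φ p ≠ 0 := fun h => hp0 (hinj (by rw [h, map_zero]))
    have hz : conjClass Y 1 (Φ p) ∈ hodgeOneZero hX' := conjClass_mem_hodgeOneZero hX' hw
    have hz0 : conjClass Y 1 (Φ p) ≠ 0 := fun h => hw0 (by
      rw [← conjClass_conjClass (Y := Y) (k := 1) (Φ p), h, conjClass_zero])
    obtain ⟨t, ht, hBz⟩ := hHR _ hz hz0
    rw [conjClass_conjClass] at hBz
    refine ⟨t, ht, ?_⟩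
    have hval : star p ⬝ᵥ (weilGramMatrix d am bm).map τ *ᵥ p = ((-(t / 4 * (ρ / y)) : ℝ) : ℂ) := by
      rw [hformτ, hBz, ← hr₀real]
      push_cast
      linear_combination ((2 * (y : ℂ))⁻¹ * (t : ℂ) * (ρ : ℂ) / 2) * Complex.I_mul_I
    rw [hval, Complex.ofReal_re]
  -- the sign of `ρ / y` decides which half is the positive one
  have hρy : ρ / y ≠ 0 := div_ne_zero hρ0 hy0
  rcases lt_or_gt_of_ne hρy with hneg | hposρ
  · refine ⟨N, P, hPN.symm, hfinN, hfinP, fun p hp hp0 => ?_, fun p hp hp0 => ?_⟩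
    · obtain ⟨t, ht, hv⟩ := hvalN p hp hp0
      rw [hv]
      exact neg_pos.2 (mul_neg_of_pos_of_neg (by positivity) hneg)
    · obtain ⟨t, ht, hv⟩ := hvalP p hp hp0
      rw [hv]
      exact mul_neg_of_pos_of_neg (by positivity) hneg
  · refine ⟨P, N, hPN, hfinP, hfinN, fun p hp hp0 => ?_, fun p hp hp0 => ?_⟩
    · obtain ⟨t, ht, hv⟩ := hvalP p hp hp0
      rw [hv]
      exact mul_pos (by positivity) hposρ
    · obtain ⟨t, ht, hv⟩ := hvalN p hp hp0
      rw [hv]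
      exact neg_neg_iff_pos.2 (mul_pos (by positivity) hposρ)

/-- **Signature `(n, n)` at every complex embedding, definite-splitting form.**  Let `dim A = 2n`, `φ² = -d`
(`d ≥ 1`) with BOTH eigenvalues `± i√d` of `φ^*` of multiplicity `n` on `H^{1,0}(A)` (Weil type), `e` a
projective embedding, `a ≠ 0` rational, `h_K = d·e^*a + φ^*e^*a`, and `(x, ω, a, b)` a Gram witness
(`x ∪ φ^*x` a basis of rational classes, `Q(x_i, φ^*x_j) = a_ij ω`, `Q(x_i, x_j) = b_ij ω`).  Then for every
embedding `τ : K_d → ℂ` there is a splitting `ℂ^{2n} = P ⊕ N`, `dim P = dim N = n`, with `τ(Ψ)` positive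
definite on `P` and negative definite on `N`. [cite: vanGeemen1994HodgeAV, Lemma 5.2 (4)]
[cite: VoisinHodgeI2002, Thm. 6.32] -/
theorem exists_definite_splitting_map_weilGram {A : AbelianVariety ℂ} {φ : A ⟶ A} {n d m : ℕ}
    (hd : 0 < d) (hA : A.dim = 2 * n) (hφ : φ ≫ φ = -(d • 𝟙 A)) (hmn : 2 * n = m + 1)
    (hP : Module.finrank ℂ ↥(Module.End.eigenspace (complexBetti.map φ.hom.hom.hom 1).hom
      (Complex.I * (Real.sqrt d : ℂ)) ⊓ hodgeOneZero (Motives.isSmoothProjective_of_dim_eq' hA)) = n)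
    (hP' : Module.finrank ℂ ↥(Module.End.eigenspace (complexBetti.map φ.hom.hom.hom 1).hom
      (-(Complex.I * (Real.sqrt d : ℂ))) ⊓ hodgeOneZero (Motives.isSmoothProjective_of_dim_eq' hA)) = n)
    (e : ProjectiveEmbedding A.X) {a : complexBetti (projectiveSpace e.n ℂ) 2} (haQ : IsRationalClass a) (ha0 : a ≠ 0)
    (x : Fin (2 * n) → complexBetti A.X 1) (ω : complexBetti A.X (2 + 2 * m))
    (am bm : Matrix (Fin (2 * n)) (Fin (2 * n)) ℚ) (hx : ∀ i, IsRationalClass (x i))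
    (hind : LinearIndependent ℂ (Sum.elim x (fun i => complexBetti.map φ.hom.hom.hom 1 (x i))))
    (hω : IsRationalClass ω) (hω0 : ω ≠ 0)
    (hQ : ∀ i j, polarizationPairingOne A.X
          ((d : ℂ) • complexBetti.map e.ι 2 a + complexBetti.map φ.hom.hom.hom 2 (complexBetti.map e.ι 2 a)) m
          (x i) (complexBetti.map φ.hom.hom.hom 1 (x j)) = ((am i j : ℚ) : ℂ) • ω ∧
        polarizationPairingOne A.X
          ((d : ℂ) • complexBetti.map e.ι 2 a + complexBetti.map φ.hom.hom.hom 2 (complexBetti.map e.ι 2 a)) m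
          (x i) (x j) = ((bm i j : ℚ) : ℂ) • ω)
    (τ : weilField d →+* ℂ) :
    ∃ P N : Submodule ℂ (Fin (2 * n) → ℂ), IsCompl P N ∧ Module.finrank ℂ P = n ∧ Module.finrank ℂ N = n ∧
      (∀ p ∈ P, p ≠ 0 → 0 < (star p ⬝ᵥ (weilGramMatrix d am bm).map τ *ᵥ p).re) ∧
      (∀ p ∈ N, p ≠ 0 → (star p ⬝ᵥ (weilGramMatrix d am bm).map τ *ᵥ p).re < 0) := by
  haveI := finite_complexBetti_abelianVariety A 1
  have hε2 : (Complex.I * (Real.sqrt d : ℂ)) * (Complex.I * (Real.sqrt d : ℂ)) = -(d : ℂ) := by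
    rw [← sq]; exact I_mul_sqrt_sq d
  have hVε : Module.finrank ℂ ↥(Module.End.eigenspace (complexBetti.map φ.hom.hom.hom 1).hom
      (Complex.I * (Real.sqrt d : ℂ))) = 2 * n := by
    have h := two_mul_finrank_eigenspace_eq hd hφ
    rw [Motives.AbelianVariety.finrank_complexBetti_one, hA] at h
    omega
  rcases embedding_weilSqrt_eq_or τ with hτ | hτ
  · exact definite_splitting_aux hd hA hφ hmn hε2 hVε hP e haQ ha0 x ω am bm hx hind hω hω0 hQ τ hτ
  · have hneg : Complex.I * ((-(Real.sqrt d) : ℝ) : ℂ) = -(Complex.I * (Real.sqrt d : ℂ)) := by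
      rw [Complex.ofReal_neg, mul_neg]
    refine definite_splitting_aux hd hA hφ hmn (y := -(Real.sqrt d)) ?_ ?_ ?_ e haQ ha0 x ω am bm hx hind hω
      hω0 hQ τ ?_
    · rw [hneg, neg_mul_neg, hε2]
    · rw [hneg, ← finrank_eigenspace_eq_finrank_eigenspace_neg hd hφ]; exact hVε
    · rw [hneg]; exact hP'
    · rw [hneg]; exact hτ

end Model

end Summit.HodgeConjecture.HodgeConjecture.Ring2.AbelianAll

end
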